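import Summits.FinalStateConjecture.FinalStateConjecture.Theorems.PhotonSphereChannelsTameHullDefs
import Summits.FinalStateConjecture.FinalStateConjecture.Theorems.ZeroEnergyRigidity.Negative.MinkowskiPresentation
import Literature.Geometry.Lorentzian.MinkowskiGlobalHyperbolicity
import Literature.Geometry.Lorentzian.TimeCones
import HarnessLib

/-!
# Route PhotonSphereChannels · crux `ChannelsResolveTameDevelopmentsR` (K2R-T2, stmt-FinalStateConjecture-17430) ·
# line `tame-lasalle-dock` · stub D `stub_dockReadyHull`, clause (G6): the FLAT HORIZON CRITERION

Clause (G6) of stub D (lead c8, Reshape 1) reads `IsMinkowski 𝓢 → E.horizon = ∅` for every silent hull element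
`(𝓢, E, p)`: a globally flat element has no future event horizon with respect to its eternal far chart. The lead's
cycle-1 report flags it as the line's risk ("asymptotic inertiality: kinematically a log-drift of the far frame is not
excluded by the weighted `C³` bounds"). This file settles the CAUSAL half of (G6) exactly and isolates the analytic
residue as one scalar condition on the far chart:

* §1 (Minkowski spacetime `(ℝ⁴, η, ∂ₜ)`, any subset `S`): `I⁻(S) = ℝ⁴` **iff** the retarded time `u = x⁰ − ‖x̲‖`
  is unbounded above on `S` (`chronologicalPast_eq_univ_iff`); then the black-hole region and the future event
  horizon of `S` are empty (`blackHoleRegionOfEnd_eq_empty_iff`, `futureEventHorizonOfEnd_eq_empty_of_forall_exists_lt`),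
  and conversely a NONEMPTY horizon forces `u` to be bounded above on `S` — the far chart is trapped under a
  null cone, every chart observer is asymptotically null with integrable lag (a Rindler-type end);
* §2 the kinematic sufficient condition: one SUBLUMINAL sequence in `S` (`‖x̲ₙ‖ ≤ (1 − δ) x⁰ₙ + K`, `x⁰ₙ → ∞`,
  `δ > 0`) makes `u` unbounded (`forall_exists_lt_of_subluminal`) — so (G6) can only fail if EVERY observer of
  the far chart drifts to the speed of light;
* §3 transport to an arbitrary spacetime `𝓢` presented as Minkowski space by `Ψ : E4 → 𝓢` (the witness of
  `TameHull.IsMinkowski 𝓢`: bijective, smooth, `Ψ^* g = η`, `Ψ_* ∂₀` future): `Ψ` maps straight future-timelike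
  segments to future timelike curves (`isFutureTimelikeCurveOn_comp_segment`), hence `I⁻(S) = 𝓢` and
  `𝓔⁺(S) = ∅` as soon as `u ∘ Ψ⁻¹` is unbounded above on `S` (`chronologicalPast_eq_univ_of_flatPresentation`,
  `futureEventHorizonOfEnd_eq_empty_of_flatPresentation`);
* §4 the form consumed by stub D: for an end datum `E` of such an `𝓢`, `E.horizon = ∅` and the black-hole region
  of `range E.far` is empty once the retarded time of the far chart (read through `Ψ`) is unbounded above
  (`horizon_eq_empty_of_flatPresentation`) — in particular once ONE chart observer is subluminal in the flat
  presentation (`horizon_eq_empty_of_subluminal_observer`); and on Minkowski spacetime itself a nonempty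
  `E.horizon` forces the far chart under a null cone (`exists_forall_far_le_of_horizon_nonempty`).

So (G6) for a flat hull element is EQUIVALENT to "the far chart reaches arbitrarily large retarded time in the flat
presentation", and a counterexample to (G6) must be an eternal `O(1/r)`-tame far chart of `ℝ⁴₁` all of whose
observers accelerate to the speed of light with integrable lag (rapidity `≥ ½ log t`). No route item is restated.

References: O'Neill 1983, Ch. 5, Lemma 5.29 and p. 145; Ch. 14, pp. 402–403 [ONeill1983]; Hawking–Ellis 1973,
§5.1, §6.6 [HawkingEllis1973]; Wald 1984, §12.1 [Wald1984]; Chruściel–Costa 2008, §2 [ChruscielCosta2008].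
-/

noncomputable section

set_option maxSynthPendingDepth 3
set_option linter.dupNamespace false

open Set Filter Function TopologicalSpace Manifold Bundle
open scoped Topology Manifold ContDiff ENNReal NNReal

namespace Summit.FinalStateConjecture.FinalStateConjecture.Theorems.TameLaSalle.FlatHorizon

open Literature.Geometry.Lorentzian
open Summit.FinalStateConjecture.FinalStateConjecture.Theorems.TameHull
open Summit.FinalStateConjecture.FinalStateConjecture.Theorems.ZeroEnergyRigidity.Negative
  (mem_chronologicalFuture_of_lt)

-- The metric and time orientation of `Minkowski.spacetime` are, by `rfl`, `LorentzianMetric.ofLE Minkowski.metric _`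
-- and `TimeOrientation.ofLE Minkowski.timeOrientation _` on the carrier `E4`; the Minkowski-side statements are
-- written in that form (no local notation), so that the instances of `E4` apply syntactically (as in
-- `MinkowskiGlobalHyperbolicity.lean`).

/-! ### §1 The retarded-time criterion in Minkowski spacetime -/

/-- **Retarded time unbounded ⇒ everything lies in the chronological past.** If `u = x⁰ − ‖x̲‖` is unbounded
above on `S ⊆ ℝ⁴₁`, then `I⁻(S) = ℝ⁴`: given `p`, a point `q ∈ S` with `q⁰ − ‖q̲‖ > p⁰ + ‖p̲‖` satisfies
`‖q̲ − p̲‖ ≤ ‖q̲‖ + ‖p̲‖ < q⁰ − p⁰`, i.e. `p ≪ q`. O'Neill 1983, Ch. 14, pp. 402–403.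
[cite: ONeill1983, Ch. 14, pp. 402–403] -/
theorem chronologicalPast_eq_univ_of_forall_exists_lt {S : Set E4}
    (hS : ∀ c : ℝ, ∃ q ∈ S, c < q 0 - ‖E4.spatial q‖) :
    LorentzianMetric.chronologicalPast (LorentzianMetric.ofLE (n' := (∞ : ℕ∞ω)) Minkowski.metric le_top)
      (TimeOrientation.ofLE (n' := (∞ : ℕ∞ω)) Minkowski.timeOrientation le_top) S = (univ : Set E4) := by
  refine eq_univ_of_forall fun p ↦ ?_
  rw [LorentzianMetric.mem_chronologicalPast_iff_exists]
  obtain ⟨q, hqS, hq⟩ := hS (p 0 + ‖E4.spatial p‖)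
  refine ⟨q, hqS, mem_chronologicalFuture_of_lt ?_⟩
  calc ‖E4.spatial q - E4.spatial p‖ ≤ ‖E4.spatial q‖ + ‖E4.spatial p‖ := norm_sub_le _ _
    _ < q 0 - p 0 := by linarith

/-- **Retarded time is monotone along `≪`**: if `u ≤ c` on `S` then `u ≤ c` on `I⁻(S)`, because `p ≪ q` implies
`p ≤ q`, i.e. `‖q̲ − p̲‖ ≤ q⁰ − p⁰` (`Minkowski.causalFuture_singleton`), whence
`p⁰ − ‖p̲‖ ≤ q⁰ − ‖q̲‖`. O'Neill 1983, Ch. 14, p. 402. [cite: ONeill1983, Ch. 14, p. 402] -/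
theorem sub_norm_le_of_mem_chronologicalPast {S : Set E4} {c : ℝ}
    (hS : ∀ q ∈ S, q 0 - ‖E4.spatial q‖ ≤ c) {p : E4}
    (hp : p ∈ LorentzianMetric.chronologicalPast (LorentzianMetric.ofLE (n' := (∞ : ℕ∞ω)) Minkowski.metric le_top)
      (TimeOrientation.ofLE (n' := (∞ : ℕ∞ω)) Minkowski.timeOrientation le_top) S) : p 0 - ‖E4.spatial p‖ ≤ c := by
  rw [LorentzianMetric.mem_chronologicalPast_iff_exists] at hp
  obtain ⟨q, hqS, hq⟩ := hp
  have hJ : q ∈ LorentzianMetric.causalFuture (LorentzianMetric.ofLE (n' := (∞ : ℕ∞ω)) Minkowski.metric le_top)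
      (TimeOrientation.ofLE (n' := (∞ : ℕ∞ω)) Minkowski.timeOrientation le_top) ({p} : Set E4) :=
    LorentzianMetric.chronologicalFuture_subset_causalFuture (LorentzianMetric.ofLE (n' := (∞ : ℕ∞ω)) Minkowski.metric le_top)
      (TimeOrientation.ofLE (n' := (∞ : ℕ∞ω)) Minkowski.timeOrientation le_top) _ hq
  rw [Minkowski.causalFuture_singleton] at hJ
  have h1 : ‖E4.spatial q‖ - ‖E4.spatial p‖ ≤ ‖E4.spatial q - E4.spatial p‖ := norm_sub_norm_le _ _
  have h2 : ‖E4.spatial q - E4.spatial p‖ ≤ q 0 - p 0 := hJ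
  linarith [hS q hqS]

/-- **Retarded time bounded ⇒ the chronological past is NOT everything**: the event `(c + 1, 0)` has
`u = c + 1 > c`. O'Neill 1983, Ch. 14, p. 402. [cite: ONeill1983, Ch. 14, p. 402] -/
theorem chronologicalPast_ne_univ_of_forall_le {S : Set E4} {c : ℝ}
    (hS : ∀ q ∈ S, q 0 - ‖E4.spatial q‖ ≤ c) :
    LorentzianMetric.chronologicalPast (LorentzianMetric.ofLE (n' := (∞ : ℕ∞ω)) Minkowski.metric le_top)
      (TimeOrientation.ofLE (n' := (∞ : ℕ∞ω)) Minkowski.timeOrientation le_top) S ≠ (univ : Set E4) := by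
  intro h
  have hp : E4.ofTimeSpace (c + 1) 0 ∈ LorentzianMetric.chronologicalPast (LorentzianMetric.ofLE (n' := (∞ : ℕ∞ω)) Minkowski.metric le_top)
      (TimeOrientation.ofLE (n' := (∞ : ℕ∞ω)) Minkowski.timeOrientation le_top) S := h ▸ mem_univ _
  have h1 := sub_norm_le_of_mem_chronologicalPast hS hp
  rw [E4.spatial_ofTimeSpace, E4.ofTimeSpace_apply_zero, norm_zero] at h1
  linarith

/-- **The flat horizon criterion (Minkowski spacetime).** `I⁻(S) = ℝ⁴` iff the retarded time `x⁰ − ‖x̲‖` is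
unbounded above on `S`. O'Neill 1983, Ch. 14, pp. 402–403. [cite: ONeill1983, Ch. 14, pp. 402–403] -/
theorem chronologicalPast_eq_univ_iff {S : Set E4} :
    LorentzianMetric.chronologicalPast (LorentzianMetric.ofLE (n' := (∞ : ℕ∞ω)) Minkowski.metric le_top)
      (TimeOrientation.ofLE (n' := (∞ : ℕ∞ω)) Minkowski.timeOrientation le_top) S = (univ : Set E4) ↔
      ∀ c : ℝ, ∃ q ∈ S, c < q 0 - ‖E4.spatial q‖ := by
  refine ⟨fun h c ↦ ?_, chronologicalPast_eq_univ_of_forall_exists_lt⟩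
  by_contra hc
  push Not at hc
  exact chronologicalPast_ne_univ_of_forall_le hc h

/-- **The black-hole region of `S` in Minkowski spacetime is empty iff the retarded time is unbounded above on
`S`** (`B = ℝ⁴ ∖ I⁻(S)`). Wald 1984, §12.1; O'Neill 1983, Ch. 14, p. 402. [cite: Wald1984, §12.1] -/
theorem blackHoleRegionOfEnd_eq_empty_iff {S : Set E4} :
    Minkowski.spacetime.blackHoleRegionOfEnd S = ∅ ↔ ∀ c : ℝ, ∃ q ∈ S, c < q 0 - ‖E4.spatial q‖ := by
  change (LorentzianMetric.chronologicalPast (LorentzianMetric.ofLE (n' := (∞ : ℕ∞ω)) Minkowski.metric le_top)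
      (TimeOrientation.ofLE (n' := (∞ : ℕ∞ω)) Minkowski.timeOrientation le_top) S)ᶜ = (∅ : Set E4) ↔ _
  rw [compl_empty_iff, chronologicalPast_eq_univ_iff]

/-- **Retarded time unbounded ⇒ empty future event horizon** (`𝓔⁺ = ∂I⁻(S) ∩ I⁺(S) = ∂ℝ⁴ ∩ I⁺(S) = ∅`).
Wald 1984, §12.1. [cite: Wald1984, §12.1] -/
theorem futureEventHorizonOfEnd_eq_empty_of_forall_exists_lt {S : Set E4}
    (hS : ∀ c : ℝ, ∃ q ∈ S, c < q 0 - ‖E4.spatial q‖) :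
    Minkowski.spacetime.futureEventHorizonOfEnd S = ∅ := by
  change frontier (LorentzianMetric.chronologicalPast (LorentzianMetric.ofLE (n' := (∞ : ℕ∞ω)) Minkowski.metric le_top)
      (TimeOrientation.ofLE (n' := (∞ : ℕ∞ω)) Minkowski.timeOrientation le_top) S) ∩
    LorentzianMetric.chronologicalFuture (LorentzianMetric.ofLE (n' := (∞ : ℕ∞ω)) Minkowski.metric le_top)
      (TimeOrientation.ofLE (n' := (∞ : ℕ∞ω)) Minkowski.timeOrientation le_top) S = (∅ : Set E4)
  rw [chronologicalPast_eq_univ_of_forall_exists_lt hS, frontier_univ, empty_inter]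

/-- **Retarded time unbounded ⇒ the d.o.c. is the whole chronological future** (`I⁺(S) ∩ I⁻(S) = I⁺(S)`).
Wald 1984, §12.1. [cite: Wald1984, §12.1] -/
theorem docOfEnd_eq_chronologicalFuture_of_forall_exists_lt {S : Set E4}
    (hS : ∀ c : ℝ, ∃ q ∈ S, c < q 0 - ‖E4.spatial q‖) :
    Minkowski.spacetime.docOfEnd S = LorentzianMetric.chronologicalFuture (LorentzianMetric.ofLE (n' := (∞ : ℕ∞ω)) Minkowski.metric le_top)
      (TimeOrientation.ofLE (n' := (∞ : ℕ∞ω)) Minkowski.timeOrientation le_top) S := by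
  change LorentzianMetric.chronologicalFuture (LorentzianMetric.ofLE (n' := (∞ : ℕ∞ω)) Minkowski.metric le_top)
      (TimeOrientation.ofLE (n' := (∞ : ℕ∞ω)) Minkowski.timeOrientation le_top) S ∩ LorentzianMetric.chronologicalPast (LorentzianMetric.ofLE (n' := (∞ : ℕ∞ω)) Minkowski.metric le_top)
      (TimeOrientation.ofLE (n' := (∞ : ℕ∞ω)) Minkowski.timeOrientation le_top) S = _
  rw [chronologicalPast_eq_univ_of_forall_exists_lt hS, inter_univ]

/-- **A nonempty horizon traps `S` under a null cone**: if `𝓔⁺(S) ≠ ∅` in Minkowski spacetime then the retarded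
time is bounded above on `S`. Wald 1984, §12.1. [cite: Wald1984, §12.1] -/
theorem exists_forall_le_of_futureEventHorizonOfEnd_nonempty {S : Set E4}
    (h : (Minkowski.spacetime.futureEventHorizonOfEnd S).Nonempty) :
    ∃ c : ℝ, ∀ q ∈ S, q 0 - ‖E4.spatial q‖ ≤ c := by
  by_contra hc
  push Not at hc
  have hS : ∀ c : ℝ, ∃ q ∈ S, c < q 0 - ‖E4.spatial q‖ := fun c ↦ by
    obtain ⟨q, hq, hlt⟩ := hc c
    exact ⟨q, hq, hlt⟩
  rw [futureEventHorizonOfEnd_eq_empty_of_forall_exists_lt hS] at h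
  exact Set.not_nonempty_empty h

/-! ### §2 The kinematic sufficient condition: one subluminal sequence -/

/-- **One subluminal sequence makes the retarded time unbounded.** If `S` contains points `qₙ` with
`‖q̲ₙ‖ ≤ (1 − δ) q⁰ₙ + K`, `δ > 0`, and `q⁰ₙ → +∞`, then `u(qₙ) ≥ δ q⁰ₙ − K → +∞`. (A chart observer whose
inertial speed stays below `1 − δ` is such a sequence; a Rindler observer is not.) O'Neill 1983, Ch. 14, p. 402.
[cite: ONeill1983, Ch. 14, p. 402] -/
theorem forall_exists_lt_of_subluminal {S : Set E4} {q : ℕ → E4} (hq : ∀ n, q n ∈ S) {δ K : ℝ}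
    (hδ : 0 < δ) (hsub : ∀ n, ‖E4.spatial (q n)‖ ≤ (1 - δ) * q n 0 + K)
    (ht : Tendsto (fun n ↦ q n 0) atTop atTop) :
    ∀ c : ℝ, ∃ p ∈ S, c < p 0 - ‖E4.spatial p‖ := by
  intro c
  obtain ⟨n, hn⟩ := (ht.eventually (eventually_gt_atTop ((c + K) / δ))).exists
  refine ⟨q n, hq n, ?_⟩
  have h1 : c + K < δ * q n 0 := by
    rw [div_lt_iff₀ hδ] at hn
    linarith
  have h2 := hsub n
  nlinarith

/-! ### §3 Transport along a flat presentation `Ψ : ℝ⁴ → 𝓢` -/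

section Transport

variable {𝓢 : Spacetime.{0} 4}

/-- Velocity of the image of an affine coordinate line: for `Ψ : E4 → 𝓢` differentiable at `x₀ + σu`, the
curve `s ↦ Ψ(x₀ + su)` is differentiable at `σ` with velocity `dΨ_{x₀+σu}(u)` (chain rule). O'Neill 1983, Ch. 1,
p. 10. [folklore] -/
theorem velocity_comp_affine (Ψ : E4 → 𝓢.carrier) (x₀ u : E4) (σ : ℝ)
    (hΨ : MDifferentiableAt 𝓘(ℝ, E4) (𝓡 4) Ψ (x₀ + σ • u)) :
    MDifferentiableAt 𝓘(ℝ, ℝ) (𝓡 4) (fun s : ℝ ↦ Ψ (x₀ + s • u)) σ ∧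
      velocity (𝓡 4) (fun s : ℝ ↦ Ψ (x₀ + s • u)) σ = mfderiv 𝓘(ℝ, E4) (𝓡 4) Ψ (x₀ + σ • u) u := by
  -- adapted from `velocity_comp_affine` of `Literature.Geometry.Lorentzian.BoostedKerrCausalLegs` (private there)
  set p : ℝ → E4 := fun s ↦ x₀ + s • u with hp
  have hpd : HasDerivAt p u σ := by
    have h := ((hasDerivAt_id σ).smul_const u).const_add x₀
    rw [one_smul] at h
    exact h
  have hpf : HasFDerivAt p ((1 : ℝ →L[ℝ] ℝ).smulRight u) σ := hasDerivAt_iff_hasFDerivAt.1 hpd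
  have hpm : HasMFDerivAt 𝓘(ℝ, ℝ) 𝓘(ℝ, E4) p σ ((1 : ℝ →L[ℝ] ℝ).smulRight u) :=
    (hasMFDerivAt_iff_hasFDerivAt (𝕜 := ℝ) (E := ℝ) (E' := E4) (f := p) (x := σ)).2 hpf
  have hcomp := hΨ.hasMFDerivAt.comp σ hpm
  refine ⟨hcomp.mdifferentiableAt, ?_⟩
  unfold velocity
  rw [show (fun s : ℝ ↦ Ψ (x₀ + s • u)) = Ψ ∘ p from rfl, hcomp.mfderiv]
  change (mfderiv 𝓘(ℝ, E4) (𝓡 4) Ψ (x₀ + σ • u)) ((ContinuousLinearMap.smulRight (1 : ℝ →L[ℝ] ℝ) u : ℝ → E4) 1) =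
    (mfderiv 𝓘(ℝ, E4) (𝓡 4) Ψ (x₀ + σ • u)) u
  congr 1
  simp

/-- **A flat presentation maps future-timelike straight segments to future timelike curves.** Let
`Ψ : ℝ⁴ → 𝓢` be smooth with `Ψ^* g = η` and `Ψ_* ∂₀` future-directed. If `q − p` is future timelike in `ℝ⁴₁`
(`‖q̲ − p̲‖ < q⁰ − p⁰`), then `σ ↦ Ψ(p + σ (q − p))` is a future-directed timelike curve of `𝓢`: its velocity
`w = dΨ(q − p)` has `g(w, w) = η(q − p, q − p) < 0`, and lies in the cone of the future timelike vector
`T = dΨ ∂₀` since `g(T, w) = η(∂₀, q − p) = −(q⁰ − p⁰) < 0` (O'Neill 1983, Ch. 5, Lemma 5.29: a causal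
vector is future-directed iff it pairs negatively with one future timelike vector). O'Neill 1983, Ch. 5, p. 145.
[cite: ONeill1983, Ch. 5, Lemma 5.29 and p. 145] -/
theorem isFutureTimelikeCurveOn_comp_segment {Ψ : E4 → 𝓢.carrier}
    (hsm : ContMDiff 𝓘(ℝ, E4) (𝓡 4) ∞ Ψ) (hdev : ∀ x, 𝓢.minkowskiDeviation Ψ x = 0)
    (hfut : ∀ x, 𝓢.timeOrientation.IsFutureDirected (mfderiv 𝓘(ℝ, E4) (𝓡 4) Ψ x (E4.basisVector 0)))
    {p q : E4} (hpq : ‖E4.spatial q - E4.spatial p‖ < q 0 - p 0) (s : Set ℝ) :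
    𝓢.metric.IsFutureTimelikeCurveOn 𝓢.timeOrientation (fun σ : ℝ ↦ Ψ (p + σ • (q - p))) s := by
  intro σ _
  set v : E4 := q - p with hv_def
  have hmd : MDifferentiableAt 𝓘(ℝ, E4) (𝓡 4) Ψ (p + σ • v) := hsm.mdifferentiableAt (by simp)
  obtain ⟨hc, hvel⟩ := velocity_comp_affine Ψ p v σ hmd
  -- metric values of pushed-forward vectors, from `Ψ^* g − η = 0`
  have hg : ∀ a b : E4, 𝓢.metric.val (Ψ (p + σ • v)) (mfderiv 𝓘(ℝ, E4) (𝓡 4) Ψ (p + σ • v) a)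
      (mfderiv 𝓘(ℝ, E4) (𝓡 4) Ψ (p + σ • v) b) = Minkowski.bilin a b := fun a b ↦ by
    have h := congrArg (fun β : E4 →L[ℝ] E4 →L[ℝ] ℝ ↦ β a b) (hdev (p + σ • v))
    simp only [Spacetime.minkowskiDeviation_apply, zero_apply, sub_eq_zero] at h
    exact h
  -- `v` is future timelike in `ℝ⁴₁`
  have hv0 : v 0 = q 0 - p 0 := by simp [hv_def]
  have hsp : E4.spatial v = E4.spatial q - E4.spatial p := by simp [hv_def]
  have hlt : ‖E4.spatial v‖ < v 0 := by rw [hsp, hv0]; exact hpq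
  have hpos : 0 < v 0 := lt_of_le_of_lt (norm_nonneg _) hlt
  have hvv : Minkowski.bilin v v < 0 := by
    have h1 : Minkowski.bilin v v = -(v 0) ^ 2 + ‖E4.spatial v‖ ^ 2 := by
      rw [Minkowski.bilin_apply, EuclideanSpace.real_norm_sq_eq]
      simp [pow_two]
    have h2 : ‖E4.spatial v‖ ^ 2 < (v 0) ^ 2 := pow_lt_pow_left₀ hlt (norm_nonneg _) two_ne_zero
    rw [h1]; linarith
  -- the pushed-forward velocity `w` and the reference future timelike vector `T = dΨ ∂₀`
  have hww : 𝓢.metric.val (Ψ (p + σ • v)) (mfderiv 𝓘(ℝ, E4) (𝓡 4) Ψ (p + σ • v) v)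
      (mfderiv 𝓘(ℝ, E4) (𝓡 4) Ψ (p + σ • v) v) < 0 := by rw [hg]; exact hvv
  have hwne : mfderiv 𝓘(ℝ, E4) (𝓡 4) Ψ (p + σ • v) v ≠ 0 := fun h0 ↦ by
    rw [h0] at hww
    simp at hww
  have hTT : 𝓢.metric.IsTimelike (mfderiv 𝓘(ℝ, E4) (𝓡 4) Ψ (p + σ • v) (E4.basisVector 0)) := by
    change 𝓢.metric.val _ _ _ < 0
    rw [hg, Minkowski.bilin_basisVector_zero_left]
    simp
  have hTw : 𝓢.metric.val (Ψ (p + σ • v)) (mfderiv 𝓘(ℝ, E4) (𝓡 4) Ψ (p + σ • v) (E4.basisVector 0))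
      (mfderiv 𝓘(ℝ, E4) (𝓡 4) Ψ (p + σ • v) v) < 0 := by
    rw [hg, Minkowski.bilin_basisVector_zero_left]
    linarith
  have hwfut : 𝓢.timeOrientation.IsFutureDirected (mfderiv 𝓘(ℝ, E4) (𝓡 4) Ψ (p + σ • v) v) :=
    (𝓢.timeOrientation.isFutureDirected_iff_val_neg (hfut _) hTT ⟨hww.le, hwne⟩).2 hTw
  refine ⟨hc, ?_, ?_⟩
  · change 𝓢.metric.val _ (velocity (𝓡 4) (fun s : ℝ ↦ Ψ (p + s • v)) σ)
      (velocity (𝓡 4) (fun s : ℝ ↦ Ψ (p + s • v)) σ) < 0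
    rw [hvel]; exact hww
  · rw [hvel]; exact hwfut

/-- **`Ψ` preserves `≪` on straight segments**: under the same hypotheses, `Ψ q ∈ I⁺(Ψ p)` whenever
`‖q̲ − p̲‖ < q⁰ − p⁰`. O'Neill 1983, Ch. 14, pp. 402–403. [cite: ONeill1983, Ch. 14, pp. 402–403] -/
theorem apply_mem_chronologicalFuture_apply {Ψ : E4 → 𝓢.carrier}
    (hsm : ContMDiff 𝓘(ℝ, E4) (𝓡 4) ∞ Ψ) (hdev : ∀ x, 𝓢.minkowskiDeviation Ψ x = 0)
    (hfut : ∀ x, 𝓢.timeOrientation.IsFutureDirected (mfderiv 𝓘(ℝ, E4) (𝓡 4) Ψ x (E4.basisVector 0)))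
    {p q : E4} (hpq : ‖E4.spatial q - E4.spatial p‖ < q 0 - p 0) :
    Ψ q ∈ 𝓢.metric.chronologicalFuture 𝓢.timeOrientation {Ψ p} :=
  ⟨Ψ p, mem_singleton _, fun σ : ℝ ↦ Ψ (p + σ • (q - p)), 0, 1, zero_lt_one,
    isFutureTimelikeCurveOn_comp_segment hsm hdev hfut hpq _, by simp, by simp⟩

/-- **Transport of the criterion.** Let `Ψ : ℝ⁴ → 𝓢` be a flat presentation (surjective, smooth, `Ψ^* g = η`,
`Ψ_* ∂₀` future-directed) and `S ⊆ 𝓢`. If the retarded time `x⁰ − ‖x̲‖` is unbounded above on `Ψ⁻¹(S)`, then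
`I⁻(S) = 𝓢`: every event is `Ψ p` for some `p`, and a preimage point `x` with `x⁰ − ‖x̲‖ > p⁰ + ‖p̲‖` gives
`Ψ p ≪ Ψ x ∈ S`. O'Neill 1983, Ch. 14, pp. 402–403; Wald 1984, §12.1. [cite: ONeill1983, Ch. 14, pp. 402–403] -/
theorem chronologicalPast_eq_univ_of_flatPresentation {Ψ : E4 → 𝓢.carrier} (hΨ : Function.Surjective Ψ)
    (hsm : ContMDiff 𝓘(ℝ, E4) (𝓡 4) ∞ Ψ) (hdev : ∀ x, 𝓢.minkowskiDeviation Ψ x = 0)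
    (hfut : ∀ x, 𝓢.timeOrientation.IsFutureDirected (mfderiv 𝓘(ℝ, E4) (𝓡 4) Ψ x (E4.basisVector 0)))
    {S : Set 𝓢.carrier} (hS : ∀ c : ℝ, ∃ x : E4, Ψ x ∈ S ∧ c < x 0 - ‖E4.spatial x‖) :
    𝓢.metric.chronologicalPast 𝓢.timeOrientation S = univ := by
  refine eq_univ_of_forall fun y ↦ ?_
  obtain ⟨p, rfl⟩ := hΨ y
  rw [LorentzianMetric.mem_chronologicalPast_iff_exists]
  obtain ⟨x, hxS, hx⟩ := hS (p 0 + ‖E4.spatial p‖)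
  refine ⟨Ψ x, hxS, apply_mem_chronologicalFuture_apply hsm hdev hfut ?_⟩
  calc ‖E4.spatial x - E4.spatial p‖ ≤ ‖E4.spatial x‖ + ‖E4.spatial p‖ := norm_sub_le _ _
    _ < x 0 - p 0 := by linarith

/-- **Transport: empty future event horizon.** Under the hypotheses of
`chronologicalPast_eq_univ_of_flatPresentation`, `𝓔⁺(S) = ∂𝓢 ∩ I⁺(S) = ∅`. Wald 1984, §12.1.
[cite: Wald1984, §12.1] -/
theorem futureEventHorizonOfEnd_eq_empty_of_flatPresentation {Ψ : E4 → 𝓢.carrier} (hΨ : Function.Surjective Ψ)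
    (hsm : ContMDiff 𝓘(ℝ, E4) (𝓡 4) ∞ Ψ) (hdev : ∀ x, 𝓢.minkowskiDeviation Ψ x = 0)
    (hfut : ∀ x, 𝓢.timeOrientation.IsFutureDirected (mfderiv 𝓘(ℝ, E4) (𝓡 4) Ψ x (E4.basisVector 0)))
    {S : Set 𝓢.carrier} (hS : ∀ c : ℝ, ∃ x : E4, Ψ x ∈ S ∧ c < x 0 - ‖E4.spatial x‖) :
    𝓢.futureEventHorizonOfEnd S = ∅ := by
  change frontier (𝓢.metric.chronologicalPast 𝓢.timeOrientation S) ∩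
    𝓢.metric.chronologicalFuture 𝓢.timeOrientation S = ∅
  rw [chronologicalPast_eq_univ_of_flatPresentation hΨ hsm hdev hfut hS, frontier_univ, empty_inter]

/-- **Transport: empty black-hole region** (`B = 𝓢 ∖ I⁻(S) = ∅`). Wald 1984, §12.1. [cite: Wald1984, §12.1] -/
theorem blackHoleRegionOfEnd_eq_empty_of_flatPresentation {Ψ : E4 → 𝓢.carrier} (hΨ : Function.Surjective Ψ)
    (hsm : ContMDiff 𝓘(ℝ, E4) (𝓡 4) ∞ Ψ) (hdev : ∀ x, 𝓢.minkowskiDeviation Ψ x = 0)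
    (hfut : ∀ x, 𝓢.timeOrientation.IsFutureDirected (mfderiv 𝓘(ℝ, E4) (𝓡 4) Ψ x (E4.basisVector 0)))
    {S : Set 𝓢.carrier} (hS : ∀ c : ℝ, ∃ x : E4, Ψ x ∈ S ∧ c < x 0 - ‖E4.spatial x‖) :
    𝓢.blackHoleRegionOfEnd S = ∅ := by
  change (𝓢.metric.chronologicalPast 𝓢.timeOrientation S)ᶜ = ∅
  rw [chronologicalPast_eq_univ_of_flatPresentation hΨ hsm hdev hfut hS, compl_univ]

end Transport

/-! ### §4 The form consumed by clause (G6) of stub D: end data of a flat spacetime -/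

section Ends

variable {𝓢 : Spacetime.{0} 4}

/-- **(G6) reduced to the retarded time of the far chart.** Let `𝓢` be presented as Minkowski space by `Ψ`
(the witness of `TameHull.IsMinkowski 𝓢`) and let `E` be ANY end datum of `𝓢`. If the retarded time of the far
chart read through `Ψ` is unbounded above — for every `c` some `x : ℝ⁴` with `Ψ x ∈ range E.far` has
`x⁰ − ‖x̲‖ > c` — then `E.horizon = ∅` and the black-hole region of the end is empty. Wald 1984, §12.1.
[cite: Wald1984, §12.1] -/
theorem horizon_eq_empty_of_flatPresentation (E : EndDatum 𝓢) {Ψ : E4 → 𝓢.carrier}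
    (hΨ : Function.Bijective Ψ) (hsm : ContMDiff 𝓘(ℝ, E4) (𝓡 4) ∞ Ψ)
    (hdev : ∀ x, 𝓢.minkowskiDeviation Ψ x = 0)
    (hfut : ∀ x, 𝓢.timeOrientation.IsFutureDirected (mfderiv 𝓘(ℝ, E4) (𝓡 4) Ψ x (E4.basisVector 0)))
    (hS : ∀ c : ℝ, ∃ x : E4, Ψ x ∈ Set.range E.far ∧ c < x 0 - ‖E4.spatial x‖) :
    E.horizon = ∅ ∧ 𝓢.blackHoleRegionOfEnd (Set.range E.far) = ∅ :=
  ⟨futureEventHorizonOfEnd_eq_empty_of_flatPresentation hΨ.2 hsm hdev hfut hS,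
    blackHoleRegionOfEnd_eq_empty_of_flatPresentation hΨ.2 hsm hdev hfut hS⟩

/-- **(G6) from ONE subluminal observer.** Same setting; if some sequence of far-chart points, read in the flat
presentation (`Ψ (y n) = E.far (z n)`), is subluminal — `‖y̲ₙ‖ ≤ (1 − δ) y⁰ₙ + K` with `δ > 0` and `y⁰ₙ → +∞` —
then `E.horizon = ∅`. This is the honest content of "asymptotic inertiality": (G6) can only fail for a flat
element all of whose far-chart observers accelerate to the speed of light with integrable lag. O'Neill 1983,
Ch. 14, p. 402; Wald 1984, §12.1. [cite: Wald1984, §12.1] -/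
theorem horizon_eq_empty_of_subluminal_observer (E : EndDatum 𝓢) {Ψ : E4 → 𝓢.carrier}
    (hΨ : Function.Bijective Ψ) (hsm : ContMDiff 𝓘(ℝ, E4) (𝓡 4) ∞ Ψ)
    (hdev : ∀ x, 𝓢.minkowskiDeviation Ψ x = 0)
    (hfut : ∀ x, 𝓢.timeOrientation.IsFutureDirected (mfderiv 𝓘(ℝ, E4) (𝓡 4) Ψ x (E4.basisVector 0)))
    {y : ℕ → E4} {z : ℕ → Kerr.region (0 : ℝ) E.R} (hyz : ∀ n, Ψ (y n) = E.far (z n)) {δ K : ℝ}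
    (hδ : 0 < δ) (hsub : ∀ n, ‖E4.spatial (y n)‖ ≤ (1 - δ) * y n 0 + K)
    (ht : Tendsto (fun n ↦ y n 0) atTop atTop) : E.horizon = ∅ := by
  have hS : ∀ c : ℝ, ∃ x : E4, Ψ x ∈ Set.range E.far ∧ c < x 0 - ‖E4.spatial x‖ := by
    intro c
    obtain ⟨x, hx, hlt⟩ := forall_exists_lt_of_subluminal (S := {x : E4 | Ψ x ∈ Set.range E.far})
      (q := y) (fun n ↦ ⟨z n, (hyz n).symm⟩) hδ hsub ht c
    exact ⟨x, hx, hlt⟩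
  exact (horizon_eq_empty_of_flatPresentation E hΨ hsm hdev hfut hS).1

/-- **On Minkowski spacetime itself** (`Ψ = id`): an end datum whose far chart reaches arbitrarily large
retarded time has empty horizon, empty black-hole region, and `E.doc = I⁺(range far)`. Wald 1984, §12.1.
[cite: Wald1984, §12.1] -/
theorem horizon_eq_empty_minkowski (E : EndDatum Minkowski.spacetime)
    (hS : ∀ c : ℝ, ∃ q : E4, q ∈ Set.range E.far ∧ c < q 0 - ‖E4.spatial q‖) :
    E.horizon = ∅ ∧ Minkowski.spacetime.blackHoleRegionOfEnd (Set.range E.far) = ∅ ∧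
      E.doc = LorentzianMetric.chronologicalFuture (LorentzianMetric.ofLE (n' := (∞ : ℕ∞ω)) Minkowski.metric le_top)
      (TimeOrientation.ofLE (n' := (∞ : ℕ∞ω)) Minkowski.timeOrientation le_top) (Set.range E.far) := by
  have hS' : ∀ c : ℝ, ∃ q ∈ (Set.range E.far : Set E4), c < q 0 - ‖E4.spatial q‖ := fun c ↦ by
    obtain ⟨q, hq, hlt⟩ := hS c
    exact ⟨q, hq, hlt⟩
  exact ⟨futureEventHorizonOfEnd_eq_empty_of_forall_exists_lt hS',
    (blackHoleRegionOfEnd_eq_empty_iff).2 hS', docOfEnd_eq_chronologicalFuture_of_forall_exists_lt hS'⟩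

/-- **The contrapositive a disproof of (G6) must realise, on Minkowski spacetime**: if an end datum of
`(ℝ⁴, η, ∂ₜ)` has NONEMPTY future event horizon, then its whole far chart lies under a null cone —
`x⁰ − ‖x̲‖ ≤ c` on `range E.far` — so every chart observer `t ↦ E.far (t, x̲)` is asymptotically null with
integrable lag (Rindler-type trapping of an eternal `O(1/r)` far chart). Wald 1984, §12.1; O'Neill 1983, Ch. 14,
p. 402. [cite: Wald1984, §12.1] -/
theorem exists_forall_far_le_of_horizon_nonempty (E : EndDatum Minkowski.spacetime) (h : E.horizon.Nonempty) :
    ∃ c : ℝ, ∀ q : E4, q ∈ Set.range E.far → q 0 - ‖E4.spatial q‖ ≤ c :=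
  exists_forall_le_of_futureEventHorizonOfEnd_nonempty (S := (Set.range E.far : Set E4)) h

/-- **The flat horizon criterion — registered sub-goal `flatHorizonCriterion` of stmt-FinalStateConjecture-17430 (clause
(G6) of stub D of line `tame-lasalle-dock`, reduced).** For every spacetime `𝓢` presented as Minkowski space by `Ψ`
(bijective, smooth, `Ψ^* g = η`, `Ψ_* ∂₀` future-directed — the four fields of `TameHull.IsMinkowski 𝓢`) and every end
datum `E` of `𝓢`: if the retarded time `x⁰ − ‖x̲‖` of the far chart, read through `Ψ`, is unbounded above, then
`E.horizon = ∅` and the black-hole region of `range E.far` is empty. Wald 1984, §12.1; O'Neill 1983, Ch. 14,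
pp. 402–403. [cite: Wald1984, §12.1] -/
theorem flatHorizonCriterion : ∀ {𝓢 : Spacetime.{0} 4} (E : EndDatum 𝓢) (Ψ : E4 → 𝓢.carrier), Function.Bijective Ψ → ContMDiff 𝓘(ℝ, E4) (𝓡 4) ∞ Ψ → (∀ x : E4, 𝓢.minkowskiDeviation Ψ x = 0) → (∀ x : E4, 𝓢.timeOrientation.IsFutureDirected (mfderiv 𝓘(ℝ, E4) (𝓡 4) Ψ x (E4.basisVector 0))) → (∀ c : ℝ, ∃ x : E4, Ψ x ∈ Set.range E.far ∧ c < x 0 - ‖E4.spatial x‖) → E.horizon = ∅ ∧ 𝓢.blackHoleRegionOfEnd (Set.range E.far) = ∅ :=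
  fun E _ hΨ hsm hdev hfut hS ↦ horizon_eq_empty_of_flatPresentation E hΨ hsm hdev hfut hS

end Ends

end Summit.FinalStateConjecture.FinalStateConjecture.Theorems.TameLaSalle.FlatHorizon

end
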